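import Summits.AtomisticToContinuum.BoseEinsteinCondensation.Theses.BECThomsonPrinciple
import Literature.MathematicalPhysics.QuantumManyBody.PeriodicBoseGasFracEnergy
import Literature.MathematicalPhysics.QuantumManyBody.PeriodicBoseGasUpperBoundProofs
import Literature.MathematicalPhysics.QuantumManyBody.ScatteringLengthRangeHolds
import Literature.MathematicalPhysics.QuantumManyBody.PeriodicBoseGasMomentumSector
import Literature.MathematicalPhysics.QuantumManyBody.WeightedCorrector

/-!
# Line `dyson-dressed-witness` for the crux `GDTransfer` (stmt-AtomisticToContinuum-9482)

Route `BECThomsonPrinciple` (rank-5 crux, wanted by this route only); planner skeleton v1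
(planner-cruxplan-stmt-AtomisticToContinuum-9482-dyson-dressed-witnes-0, 2026-08-16).

**The crux.** `GDTransfer : GaussianDominationCan → PeriodicBEC` — canonical `T = 0` Gaussian
domination on the torus (chord form, LNSS excitation source `2|⟨Φ, Λ_k†Φ⟩|`, every window mode
`0 < |k| ≤ M√ρ`, every periodic trial state `Φ`) implies condensation of the `δ`-near-minimisers
of the periodic energy in the constant mode at every small density (`PeriodicBEC`, verbatim the
consequent; `= BECPeriodicReduction.PeriodicBEC`).

**The line (card `dyson-dressed-witness`, ideator 1; triage r1: pass ×3, ranked strongest).**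
Variational `T = 0` Kennedy–Lieb–Shastry at a `δ`-near-minimiser `Ψ`, with the WITNESS dressed,
not the state: the chord inequality of `GaussianDominationCan`, differentiated along
`Φ_t = (Ψ + tζ)/‖Ψ + tζ‖`, is a two-sided dual-norm bound
`(N|⟨ζ₊,Λ†Ψ⟩/N + ⟨ΛΨ,ζ₋⟩/N|)² ≤ 2C_k (q̃(ζ₊) + q̃(ζ₋)) + o_δ(1)` (`C_k = C L²/‖n‖²`,
`q̃(ζ) = 𝓔(ζ) − E₀‖ζ‖²`) valid for EVERY pair of admissible directions `ζ±` (stub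
`stub_chordVariation`, the only place GD is consumed); the directions are then chosen as the
CORE-SAFE Dyson–Jastrow sandwich `ζ₊ = Λ̃_k†Ψ`, `ζ₋ = Λ̃_kΨ`,
`Λ̃_k = G(ñ₀)(Σᵢ Fᵢ Pᵢ e^{-ik·xᵢ} Fᵢ)G(ñ₀)`, `Fᵢ = Π_{j≠i} f(xᵢ − xⱼ)` with `f` the (mollified)
zero-energy scattering profile of the GIVEN `v`, `ñ₀ = Σᵢ FᵢPᵢFᵢ`, `G(n) = (n+1)^{-1/4}`: their
excess energy is at most `(c₁k² + c₂ρa)·(1 + ‖ζ₊‖² + ‖ζ₋‖²)` with `a` the SCATTERING LENGTH (the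
interaction double commutator vanishes identically on the cores; what is paid is the dressing
energy `∫|∇f|² ≈ 8πρa` per unit flat mass), and their first-order response recovers the flat mass
`‖ζ₊‖² + ‖ζ₋‖² ≈ 2n_k + 1` up to a dressing defect whose WINDOW SUM is `O(√(ρa³))·N` (stub
`stub_dressedWitness`, the load-bearing one). Solving the per-mode quadratic inequality and counting
the `O(M³√ρ N)` window modes gives `Σ_window n_k ≤ K√ρ·N` (stub `stub_windowLaw`); Parseval on the
cell (`Σ_p n_p = N`, in tree), kinetic Chebyshev above the window (`Σ_p |k_p|² n_p = T(Ψ)`, in tree)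
and Dyson's upper bound (`LSSY2005_upperBound_periodic_holds`, in tree) give
`⟨Ψ, n̂₀Ψ⟩ ≥ N/2` for `ρ < ρ₀(v)` (stub `stub_modeCounting`, provable now).

`GDTransfer_of : Sig.stub_chordVariation → Sig.stub_dressedWitness → Sig.stub_windowLaw →
Sig.stub_modeCounting → GDTransfer` is sorry-free; the unnamed `example` at the end applies it to
the four sorried stubs, so the file is a proof of the crux modulo the registered stubs. Each stub's
statement is the `Prop` `Sig.stub_<name>`; the registered obligation is
`theorem stub_<name> : Sig.stub_<name> := by sorry` (layer-invariant audit: hypothesis heads =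
stub names; the convention of `Cruxes/FibreConductance/Lines/conditional-law-poincare.lean`).
`gaussianDominationCan_iff` / `gdTransfer_iff` (by `Iff.rfl`) pin this file's vocabulary
(`cellAvg`, `modeProj`, `theta`, `wave0`, `srcPair`, `Consequent`) to the crux DEFINITIONALLY.

**Disproof.lean (refuter-cdisprove gen-1 v1–v4, gen-2 v1–v3b; read through the item's evidence
notes — `run/gate/evidence/…` is not mounted in planner jails and no `Cruxes/GDTransfer/Disproof.lean`
is published) — obligations honoured.** `not_gdTransfer_iff` (¬GDTransfer ↔ GDCan ∧ ¬PeriodicBEC: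
the crux RESISTS, any proof must USE GD): GD is consumed, at every `t` and at `t = 0`, in
`stub_chordVariation` (`H = GaussianDominationCan` is literally its antecedent).
`gdTransferPointwise_false_without_finiteRange` / `eventually_periodicGroundStateEnergy_ne_top`
(any proof must use `E₀^per < ∞` at low density): `E₀ ≠ ⊤` is an explicit hypothesis of
`TwoSidedDualNorm`, `DressedWitnessFamily`, `WindowBound` and is DISCHARGED in `stub_modeCounting`
by Dyson's bound along `L_N = (N/ρ)^{1/3}`. `periodicBECAtLinearWindow_false` (`δ = εN` never
certifies a fraction; resolution must be `o(N^{1/3})`): every `δ` here is `∃ δ` AFTER `N, L`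
(near-minimality at fixed volume), never an energy density. `gdChord_of_energy_top` (GD is silent at
infinite-energy states = hard-core voidness of the verbatim KLS variation): the variation runs only
through finite-energy directions (`eform ≤ R` in `stub_chordVariation`) and the witnesses of
`stub_dressedWitness` are core-safe on BOTH sides (two-sided sandwich `FᵢPᵢFᵢ`), so no contact layer
and no `⊤`-arithmetic ever enters. §5 `truncation_dichotomy` (the interaction constant must be the
scattering length, never `∫v`): `stub_dressedWitness` prices the interaction by
`c₂ ρ (scatteringLength v).toReal`. §6 `gaussianDominationCan_free_constant_ge` (`C ≥ 1/4π²` at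
`v = 0`): no stub assumes a small `C`; constants are existential after `v, M`. `theta_wordSum`
(the inline `P/Q/Θ` source IS `a_k†a_0 n̂₀^{-1/2}`): relied on for the sign/normalisation of
`srcPair` (checked again in the line card). No Negative lemma has landed under
`Theorems/GDTransfer/` (the directory does not exist, 2026-08-16); `ledger negatives` (12 entries,
per the three triage files) share no object with this line.
-/

noncomputable section

open MeasureTheory
open scoped ENNReal ComplexConjugate

namespace Summit.AtomisticToContinuum.BoseEinsteinCondensation.Cruxes.GDTransfer.DysonDressedWitness

open Literature.MathematicalPhysics.QuantumManyBody.BoseGas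
open Summit.AtomisticToContinuum.BoseEinsteinCondensation.Theses.BECThomsonPrinciple

/-! ## §0 Vocabulary of the crux (definitionally the crux's `let`s; see `gaussianDominationCan_iff`) -/

variable {m : ℕ}

/-- `Pᵢ g (X) = L⁻³ ∫_cell g(X with xᵢ ↦ y) dy` — the cell average of particle `i` (the crux's `P`;
the projection of slot `i` onto the constant mode). -/
def cellAvg (L : ℝ) (i : Fin (m + 1)) (g : Config (m + 1) → ℂ) : Config (m + 1) → ℂ :=
  fun X => ((L ^ 3)⁻¹ : ℝ) • ∫ y in cell L, g (Function.update X i y)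

/-- `Q_S g` — project the slots in `S` onto the constant mode and the others off it (the crux's `Q`;
a word-sum projection, `theta_wordSum` of the disprover's file). -/
def modeProj (L : ℝ) (S : Finset (Fin (m + 1))) (g : Config (m + 1) → ℂ) : Config (m + 1) → ℂ :=
  (List.finRange (m + 1)).foldr (fun i h => if i ∈ S then cellAvg L i h else h - cellAvg L i h) g

/-- `Θ g = Σ_{S ∋ 0} |S|^{-1/2} Q_S g = P₀ n̂₀^{-1/2} g` (the crux's `Θ`, as a function of `g`). -/
def theta (L : ℝ) (g : Config (m + 1) → ℂ) : Config (m + 1) → ℂ := fun X =>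
  ∑ S ∈ (Finset.univ : Finset (Finset (Fin (m + 1)))).filter (fun S => (0 : Fin (m + 1)) ∈ S),
    ((Real.sqrt (S.card : ℝ))⁻¹ : ℂ) * modeProj L S g X

/-- `e^{ik·x₀}`, `k = 2πn/L` (verbatim the crux's phase factor on particle `0`). -/
def wave0 (L : ℝ) (n : Fin 3 → ℤ) (X : Config (m + 1)) : ℂ :=
  Complex.exp (Complex.I * ↑(2 * Real.pi / L * ∑ j, (n j : ℝ) * X 0 j))

/-- The SOURCE PAIRING `σ_k(g, h) = ∫_{cell^N} conj(g) e^{ik·x₀} Θ_h` (conjugate-linear in `g`,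
linear in `h`). For Bose-symmetric `g, h`: `N·σ_k(g, h) = ⟨g, Λ_k† h⟩` with the
Lewin–Nam–Serfaty–Solovej excitation creator `Λ_k† = a_k† a_0 n̂₀^{-1/2}`; the crux's source is
`2N|σ_k(Φ, Φ)| = 2|⟨Φ, Λ_k†Φ⟩|` (`gaussianDominationCan_iff`). -/
def srcPair (L : ℝ) (n : Fin 3 → ℤ) (g h : Config (m + 1) → ℂ) : ℂ :=
  ∫ X in cellN (m + 1) L, conj (g X) * wave0 L n X * theta L h X

/-- The crux's window: `k = 2πn/L ≠ 0` with `2π‖n‖_∞/L ≤ M √(N/L³)` (sup norm, as in the crux). -/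
def InWindow (M : ℝ) (m : ℕ) (L : ℝ) (n : Fin 3 → ℤ) : Prop :=
  n ≠ 0 ∧ 2 * Real.pi * ‖(fun j => (n j : ℝ))‖ / L ≤ M * Real.sqrt ((m + 1 : ℕ) / L ^ 3)

/-- The antecedent of the crux restated with the vocabulary above — DEFINITIONALLY (`Iff.rfl`). -/
theorem gaussianDominationCan_iff :
    GaussianDominationCan ↔
    ∀ v : ℝ → ℝ≥0∞, IsRepulsiveFiniteRange v → ∀ M : ℝ, 0 < M → ∃ ρ₀ C : ℝ, 0 < ρ₀ ∧ 0 < C ∧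
      ∃ N₀ : ℕ, ∀ m : ℕ, N₀ ≤ m + 1 → ∀ L : ℝ, 0 < L → ((m + 1 : ℕ) : ℝ) ≤ ρ₀ * L ^ 3 →
        ∀ n : Fin 3 → ℤ, n ≠ 0 →
          2 * Real.pi * ‖(fun j => (n j : ℝ))‖ / L ≤ M * Real.sqrt ((m + 1 : ℕ) / L ^ 3) →
            ∀ s : ℝ, 0 ≤ s → ∀ Φ : PeriodicTrialState (m + 1) L,
              periodicGroundStateEnergy v (m + 1) L +
                  ENNReal.ofReal (s * (2 * (m + 1) * ‖srcPair L n Φ.ψ Φ.ψ‖)) ≤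
                periodicEnergy v Φ + ENNReal.ofReal (C * s ^ 2 * L ^ 2 / ‖(fun j => (n j : ℝ))‖ ^ 2) :=
  Iff.rfl

/-! ## §1 Variation directions, their mass and energy form; occupations and window sums -/

/-- Admissible VARIATION DIRECTIONS at `(N, L) = (m+1, L)`: `C¹`, `Lℤ³`-periodic in every particle,
Bose-symmetric — exactly the data of a `PeriodicTrialState` without the normalisation, so that
`(Ψ + tζ)/‖Ψ + tζ‖` is again a periodic trial state. -/
structure IsDirection (m : ℕ) (L : ℝ) (ζ : Config (m + 1) → ℂ) : Prop where
  contDiff : ContDiff ℝ 1 ζ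
  periodic : ∀ (X : Config (m + 1)) (i : Fin (m + 1)) (k : Fin 3),
    ζ (X + Pi.single i (EuclideanSpace.single k L)) = ζ X
  symm : ∀ (σ : Equiv.Perm (Fin (m + 1))) (X : Config (m + 1)), ζ (X ∘ σ) = ζ X

/-- `‖ζ‖² = ∫_{cell^N} |ζ|²` (the mass of a direction). -/
def mass (L : ℝ) (ζ : Config (m + 1) → ℂ) : ℝ≥0∞ :=
  ∫⁻ X in cellN (m + 1) L, (‖ζ X‖₊ : ℝ≥0∞) ^ 2

/-- `𝓔(ζ) = ∫_{cell^N} (|∇ζ|² + Σ_{i<j} v^per(xᵢ−xⱼ)|ζ|²)` — the periodic energy FORM of an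
unnormalised function (`= periodicEnergy` on trial states, `eform_trialState`). The excess form of
the line is `q̃(ζ) = 𝓔(ζ) − E₀‖ζ‖²`, always written additively below. -/
def eform (v : ℝ → ℝ≥0∞) (L : ℝ) (ζ : Config (m + 1) → ℂ) : ℝ≥0∞ :=
  ∫⁻ X in cellN (m + 1) L, kineticDensity ζ X + periodicInteraction v L X * (‖ζ X‖₊ : ℝ≥0∞) ^ 2

/-- A periodic trial state is a direction. -/
theorem isDirection_trialState {L : ℝ} (Ψ : PeriodicTrialState (m + 1) L) : IsDirection m L Ψ.ψ :=
  ⟨Ψ.contDiff, Ψ.periodic, Ψ.symm⟩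

/-- Its mass is `1`. -/
theorem mass_trialState {L : ℝ} (Ψ : PeriodicTrialState (m + 1) L) : mass L Ψ.ψ = 1 := Ψ.norm_eq

/-- Its energy form is its periodic energy (by `rfl`). -/
theorem eform_trialState {L : ℝ} (v : ℝ → ℝ≥0∞) (Ψ : PeriodicTrialState (m + 1) L) :
    eform v L Ψ.ψ = periodicEnergy v Ψ := rfl

/-- `n_p(Ψ) = ⟨φ_p, γ_Ψ φ_p⟩` — occupation of the plane wave `φ_p = L^{-3/2}e^{2πi p·x/L}`
(`cellOccupation` of `planeWaveMode`, `PeriodicBoseGasFracEnergy`; `Σ_p n_p = N`,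
`Σ_p |2πp/L|² n_p = T(Ψ)` are proved there; `n_0 = condensateOccupation`, `occ_zero`). -/
def occ (L : ℝ) (p : Fin 3 → ℤ) (Ψ : Config (m + 1) → ℂ) : ℝ≥0∞ :=
  cellOccupation (m + 1) L (planeWaveMode L p) Ψ

/-- `n_0(Ψ) = ⟨Ψ, n̂₀ Ψ⟩`. -/
theorem occ_zero (L : ℝ) (Ψ : Config (m + 1) → ℂ) : occ L 0 Ψ = condensateOccupation (m + 1) L Ψ :=
  cellOccupation_planeWaveMode_zero _ _ _

/-- `Σ_{p ∈ window(M)} f p` — sum of `f` over the crux's window modes (a `tsum` of an indicator, so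
no finiteness of the window is presupposed; it is finite, `#window ≤ (2J+1)³`, `J = M√ρ L/2π`). -/
def windowSum (M : ℝ) (m : ℕ) (L : ℝ) (f : (Fin 3 → ℤ) → ℝ≥0∞) : ℝ≥0∞ :=
  ∑' p : Fin 3 → ℤ, {p | InWindow M m L p}.indicator f p

/-! ## §2 The statements of the line -/

/-- TWO-SIDED DUAL-NORM BOUND AT NEAR-MINIMISERS (the output of `stub_chordVariation`; GD enters the
line only through it). For every admissible `v`, window parameter `M`: constants `ρ₀, C, N₀` (those
of `GaussianDominationCan`) such that for `N = m+1 ≥ N₀`, `L > 0`, `N ≤ ρ₀L³`, `E₀ = E₀^per(N,L) < ∞`,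
every window mode `n` and every tolerance `η > 0` and a-priori radius `R`, there is a slack `δ > 0`
(depending on all of these) such that for every `δ`-near-minimiser `Ψ` and every pair of directions
`ζ₊, ζ₋` with mass and energy form `≤ R`:
`(N |σ(ζ₊,Ψ) + σ(Ψ,ζ₋)|)² + 2C_k E₀ (‖ζ₊‖² + ‖ζ₋‖²) ≤ 2C_k (𝓔(ζ₊) + 𝓔(ζ₋)) + η`,
`C_k = C L²/‖n‖²` — i.e. `(N|⟨ζ₊,Λ†Ψ⟩/N + ⟨ΛΨ,ζ₋⟩/N|)² ≤ 2C_k (q̃(ζ₊) + q̃(ζ₋)) + η`. -/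
def TwoSidedDualNorm : Prop :=
  ∀ v : ℝ → ℝ≥0∞, IsRepulsiveFiniteRange v → ∀ M : ℝ, 0 < M →
    ∃ ρ₀ C : ℝ, 0 < ρ₀ ∧ 0 < C ∧ ∃ N₀ : ℕ, ∀ m : ℕ, N₀ ≤ m + 1 →
      ∀ L : ℝ, 0 < L → ((m + 1 : ℕ) : ℝ) ≤ ρ₀ * L ^ 3 →
        periodicGroundStateEnergy v (m + 1) L ≠ ⊤ →
        ∀ n : Fin 3 → ℤ, InWindow M m L n → ∀ η R : ℝ, 0 < η → 0 < R →
          ∃ δ : ℝ≥0∞, 0 < δ ∧ ∀ Ψ : PeriodicTrialState (m + 1) L,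
            periodicEnergy v Ψ ≤ periodicGroundStateEnergy v (m + 1) L + δ →
            ∀ ζp ζm : Config (m + 1) → ℂ, IsDirection m L ζp → IsDirection m L ζm →
              mass L ζp ≤ ENNReal.ofReal R → mass L ζm ≤ ENNReal.ofReal R →
              eform v L ζp ≤ ENNReal.ofReal R → eform v L ζm ≤ ENNReal.ofReal R →
                ENNReal.ofReal (((m + 1 : ℕ) * ‖srcPair L n ζp Ψ.ψ + srcPair L n Ψ.ψ ζm‖) ^ 2) +
                    ENNReal.ofReal (2 * C * L ^ 2 / ‖(fun j => (n j : ℝ))‖ ^ 2) *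
                      periodicGroundStateEnergy v (m + 1) L * (mass L ζp + mass L ζm) ≤
                  ENNReal.ofReal (2 * C * L ^ 2 / ‖(fun j => (n j : ℝ))‖ ^ 2) *
                      (eform v L ζp + eform v L ζm) +
                    ENNReal.ofReal η

/-- DRESSED WITNESS FAMILY (the output of `stub_dressedWitness` — the load-bearing statement of the
line; unconditional, no GD). For every admissible `v` and window parameter `M`: constants
`ρ₁, c₁, c₂, γ, N₁` such that for `N = m+1 ≥ N₁`, `L > 0`, `N ≤ ρ₁L³`, `E₀ < ∞`, there are an
a-priori radius `R` and a slack `δ > 0` such that every `δ`-near-minimiser `Ψ` admits a defect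
budget `d : ℤ³ → [0,∞]` with WINDOW SUM `Σ_{window} d ≤ γ √ρ N` (`ρ = N/L³`) and, for every
window mode `n` (`k = 2πn/L`), two directions `ζ₊, ζ₋` (intended: `Λ̃_k†Ψ`, `Λ̃_kΨ` with the
core-safe Dyson-dressed LNSS operator) of mass and energy form `≤ R` with
(W2) DRESSED SECOND VARIATION `𝓔(ζ₊) + 𝓔(ζ₋) ≤ E₀(‖ζ₊‖² + ‖ζ₋‖²) + (c₁k_∞² + c₂ρa)(1 + ‖ζ₊‖² + ‖ζ₋‖²)`,
`a = scatteringLength v` (hard cores: the interaction double commutator is identically `0`, the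
price is the dressing energy `≈ 8πρa` per unit flat mass; `k²·O(1)` is `k²⟨[Λ̃,Λ̃†]⟩`);
(W3) FIRST-ORDER RESPONSE `‖ζ₊‖² + ‖ζ₋‖² ≤ 2N|σ(ζ₊,Ψ) + σ(Ψ,ζ₋)| + d(n)`
(`N σ(ζ₊,Ψ) + N σ(Ψ,ζ₋) = ⟨Λ̃†Ψ, Λ†Ψ⟩ + ⟨ΛΨ, Λ̃Ψ⟩ = ‖ζ₊‖² + ‖ζ₋‖² + ⟨ζ₊, D₊Ψ⟩ + ⟨D₋Ψ, ζ₋⟩`,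
`D± = Λ^{(†)} − Λ̃^{(†)}`, and `|⟨ζ,DΨ⟩| ≤ ½‖ζ‖² + ½‖DΨ‖²`, so `d(n) ≥ ‖D₊Ψ‖² + ‖D₋Ψ‖²` — purely
QUADRATIC in the dressing defects — suffices for the factor `2`);
(W4) OCCUPATION LINK `n_k(Ψ) ≤ 2‖ζ₋‖² + d(n)` (`n_k = ‖Λ_kΨ‖²` exactly, `Λ†Λ = n̂_k`).
The window-summed defect is then `O(ρa³)·N ≤ γ√ρ·N` by the Parseval-in-`k` bound
`Σ_k ‖(Λ̃_k − Λ_k)Ψ‖² = O(ρa³N)` (triage r1-2 sharpening: diagonal part by the shell Poincaré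
inequality + Dyson, coherent part cancelled by `G(ñ₀)² ≈ 1/n̂₀`). -/
def DressedWitnessFamily : Prop :=
  ∀ v : ℝ → ℝ≥0∞, IsRepulsiveFiniteRange v → ∀ M : ℝ, 0 < M →
    ∃ ρ₁ c₁ c₂ γ : ℝ, 0 < ρ₁ ∧ 0 < c₁ ∧ 0 < c₂ ∧ 0 < γ ∧ ∃ N₁ : ℕ, ∀ m : ℕ, N₁ ≤ m + 1 →
      ∀ L : ℝ, 0 < L → ((m + 1 : ℕ) : ℝ) ≤ ρ₁ * L ^ 3 →
        periodicGroundStateEnergy v (m + 1) L ≠ ⊤ →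
        ∃ R : ℝ, 0 < R ∧ ∃ δ : ℝ≥0∞, 0 < δ ∧ ∀ Ψ : PeriodicTrialState (m + 1) L,
          periodicEnergy v Ψ ≤ periodicGroundStateEnergy v (m + 1) L + δ →
          ∃ d : (Fin 3 → ℤ) → ℝ≥0∞,
            windowSum M m L d ≤
                ENNReal.ofReal (γ * Real.sqrt ((m + 1 : ℕ) / L ^ 3) * (m + 1)) ∧
            ∀ n : Fin 3 → ℤ, InWindow M m L n →
              ∃ ζp ζm : Config (m + 1) → ℂ, IsDirection m L ζp ∧ IsDirection m L ζm ∧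
                mass L ζp ≤ ENNReal.ofReal R ∧ mass L ζm ≤ ENNReal.ofReal R ∧
                eform v L ζp ≤ ENNReal.ofReal R ∧ eform v L ζm ≤ ENNReal.ofReal R ∧
                eform v L ζp + eform v L ζm ≤
                    periodicGroundStateEnergy v (m + 1) L * (mass L ζp + mass L ζm) +
                      ENNReal.ofReal
                        ((c₁ * (2 * Real.pi * ‖(fun j => (n j : ℝ))‖ / L) ^ 2 +
                            c₂ * ((m + 1 : ℕ) / L ^ 3) * (scatteringLength v).toReal) *
                          (1 + (mass L ζp + mass L ζm).toReal)) ∧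
                mass L ζp + mass L ζm ≤
                    2 * ENNReal.ofReal ((m + 1 : ℕ) * ‖srcPair L n ζp Ψ.ψ + srcPair L n Ψ.ψ ζm‖) +
                      d n ∧
                occ L n Ψ.ψ ≤ 2 * mass L ζm + d n

/-- WINDOW BOUND (the output of `stub_windowLaw`): for every admissible `v` and window parameter `M`
there are `ρ₁, K, N₁` such that for `N = m+1 ≥ N₁`, `L > 0`, `N ≤ ρ₁L³`, `E₀ < ∞`, some slack
`δ > 0` makes every `δ`-near-minimiser `Ψ` satisfy `Σ_{0 < |k| ≤ M√ρ} n_k(Ψ) ≤ K √ρ N`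
(`ρ = N/L³`; `o(N)` as `ρ → 0` at fixed `M`: the KLS window law `n_k ≤ α + βρa/k² + 3d(k)` summed
over the `O(M³√ρN)` window modes, `Σ_{window} ρa/k² = O(M a √ρ)N`, `Σ d = O(√(ρa³))N`). -/
def WindowBound : Prop :=
  ∀ v : ℝ → ℝ≥0∞, IsRepulsiveFiniteRange v → ∀ M : ℝ, 0 < M →
    ∃ ρ₁ K : ℝ, 0 < ρ₁ ∧ 0 < K ∧ ∃ N₁ : ℕ, ∀ m : ℕ, N₁ ≤ m + 1 →
      ∀ L : ℝ, 0 < L → ((m + 1 : ℕ) : ℝ) ≤ ρ₁ * L ^ 3 →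
        periodicGroundStateEnergy v (m + 1) L ≠ ⊤ →
        ∃ δ : ℝ≥0∞, 0 < δ ∧ ∀ Ψ : PeriodicTrialState (m + 1) L,
          periodicEnergy v Ψ ≤ periodicGroundStateEnergy v (m + 1) L + δ →
            windowSum M m L (fun p => occ L p Ψ.ψ) ≤
              ENNReal.ofReal (K * Real.sqrt ((m + 1 : ℕ) / L ^ 3) * (m + 1))

/-- The consequent of the crux, verbatim (`PeriodicBEC`: condensation of the near-minimisers of the
periodic problem in the constant mode at every small density; `gdTransfer_iff`). -/
def Consequent : Prop :=
  ∀ v : ℝ → ℝ≥0∞, IsRepulsiveFiniteRange v → ∃ ρ₀ : ℝ, 0 < ρ₀ ∧ ∀ ρ : ℝ, 0 < ρ → ρ < ρ₀ →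
    ∃ c : ℝ, 0 < c ∧ ∀ᶠ N : ℕ in Filter.atTop, ∃ δ : ℝ≥0∞, 0 < δ ∧
      ∀ Ψ : PeriodicTrialState N (sideLength ρ N),
        periodicEnergy v Ψ ≤ periodicGroundStateEnergy v N (sideLength ρ N) + δ →
          ENNReal.ofReal (c * N) ≤ condensateOccupation N (sideLength ρ N) Ψ.ψ

/-- The crux is `GaussianDominationCan → Consequent`, DEFINITIONALLY. -/
theorem gdTransfer_iff : GDTransfer ↔ (GaussianDominationCan → Consequent) := Iff.rfl

/-! ## §3 Stub signatures (`Sig.stub_<name>` = the registered signature, textually) -/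

/-- **Signature of `stub_chordVariation` — THE VARIATIONAL KLS STEP (size M–L; real/functional
analysis, no physics).** `GaussianDominationCan → TwoSidedDualNorm`. Proof plan (all three triagers
re-derived it): optimise the chord in `s` at finite energy (`chord_iff_sq`: `S(Φ)² ≤ 4C_k(E(Φ)−E₀)`,
`S = 2N|σ(Φ,Φ)|`); apply it to `Φ_t = (Ψ + tζ_θ)/‖·‖` (`PeriodicTrialState.ofFun`; `ζ_θ =
e^{iθ}ζ₊ + e^{-iθ}ζ₋` is a direction), expand `σ(Φ_t,Φ_t)` and `E(Φ_t)` in `t` (sesquilinearity of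
`srcPair`, quadraticity of `eform`; `q̃(ζ,Ψ)`-cross term `≤ √(δ q̃(ζ))` by Cauchy–Schwarz for the
non-negative form `𝓔 − E₀‖·‖²` on directions), and conclude with the real-variable kernel
`ChordLimitKLS` (card slack-first-phase-averaged-kls, `SketchIdeator3.lean`; `t = δ^{1/4}`) — the
a-priori bounds `|y| ≤ 4NR`, `|r| ≤ √R`, `m ≤ 4R` come from `mass, eform ≤ R` and `‖Θ‖ ≤ 1`;
finally choose `θ` aligning `e^{-2iθ}·(anomalous term)` with the main term, so that
`max_θ |σ(ζ_θ,Ψ) + σ(Ψ,ζ_θ)| ≥ |σ(ζ₊,Ψ) + σ(Ψ,ζ₋)|`, and `q̃(ζ_θ) ≤ 2q̃(ζ₊) + 2q̃(ζ₋)`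
(parallelogram law + `q̃ ≥ 0`). Why it might fail: only through a slip in the `t`-expansion or the
`ℝ≥0∞` bookkeeping (statement true at `v = 0` with GD's `C = 1/4π²`). [KennedyLiebShastry1988 (12)–(14);
DysonLiebSimon1978 Thm 3.1; arXiv:1211.2778] -/
def Sig.stub_chordVariation : Prop :=
  GaussianDominationCan → TwoSidedDualNorm

/-- **Signature of `stub_dressedWitness` — THE DYSON-DRESSED CORE-SAFE WITNESS (size XL; the new
mathematics; HARDEST).** `DressedWitnessFamily`. Construction: `ζ₊ = Λ̃_k†Ψ`, `ζ₋ = Λ̃_kΨ`,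
`Λ̃_k = G(ñ₀)(Σᵢ FᵢPᵢe^{-ik·xᵢ}Fᵢ)G(ñ₀)` (or the Γ-linearised symmetrised dressed product of card
gamma-linearised-root in place of the functional calculus `G`), `Fᵢ = Π_{j≠i} f(xᵢ−xⱼ)` with `f` the
`C¹`-mollified scattering profile of the given `v` healed to `1` at `R ≍ (ρ)^{-1/3}/4` (tree:
`LSSY2005_dysonProfile_holds`, `IsPairProfile`, `scatteringProfileLim_eq_one_sub_div`). (W2): at a
near-minimiser the rewrite `q̃(Λ̃†Ψ) + q̃(Λ̃Ψ) = ½⟨[Ã,[H,Ã]]⟩ + O(√δ)` is legitimate because `ÃΨ`,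
`Ã²Ψ` vanish on the cores (two-sidedness; triage F2), `[T, Pᵢe^{-ikxᵢ}] = −k²Pᵢe^{-ikxᵢ}`, every
commutator with a dressing factor or with `T_j` is two- or three-body local, and the flat moved particle
pays `∫(k²F² + |∇₀F|²)|g|²` exactly (`FlatDressingIdentity`, `Cruxes/GDTransfer/Sketch.lean`) —
Dyson–LSSY Jastrow bookkeeping (`PeriodicBoseGasJastrow`, `lintegral_cellN_kernel_mul_le`,
`BoseGasHardCoreContact.sum_lintegral_shellPair_le`) against the UNKNOWN near-minimiser, for which
only `T(Ψ) ≤ E₀ + δ ≤ 4πaρN(1+o(1)) + δ` (Dyson) and flat-particle identities are available.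
(W3)/(W4) + budget: `|N σ(ζ₊,Ψ) + N σ(Ψ,ζ₋) − ‖ζ₊‖² − ‖ζ₋‖²| ≤ ‖ζ₊‖‖D₊Ψ‖ + ‖ζ₋‖‖D₋Ψ‖`,
`n_k ≤ 2‖ζ₋‖² + 2‖D₋Ψ‖²`, `D± = Λ± − Λ̃±`, so `d(n) = ‖D₊Ψ‖² + 3‖D₋Ψ‖²` works, and
`Σ_k ‖D±Ψ‖² = O(ρa³N)` by Parseval in `k` (diagonal `Σᵢ‖(1−Fᵢ)Ψ‖² ≤ Cδ'²T(Ψ)` by the shell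
Poincaré inequality, coherent part cancelled by `G(ñ₀)² ≈ 1/n̂₀`), whence
`Σ_window d = O(ρa³)N ≤ γ√ρ N`. Why it might fail: the
coherent first-order defect (`Σᵢ e^{ikxᵢ}Pᵢ(Fᵢ−1)` converts the bath density wave into a fake
removal signal) is controlled only window-summed, and the `G(ñ₀)` normalisation against `1/n̂₀`
must hold on every `n₀`-sector of an uncondensed near-minimiser — unverified beyond the two ends
(condensate / fully depleted); Duhamel for `[H, G(ñ₀)]` through the non-commuting family `{FᵢPᵢFᵢ}`.
[LSSY2005 Thm 2.2 (2.19)–(2.31), App. C; Dyson1957; arXiv:1211.2778; arXiv:2203.11917;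
KennedyLiebShastry1988] -/
def Sig.stub_dressedWitness : Prop :=
  DressedWitnessFamily

/-- **Signature of `stub_windowLaw` — PER-MODE SOLVE AND WINDOW COUNT (size M; elementary).**
`TwoSidedDualNorm → DressedWitnessFamily → WindowBound`. Per window mode, with `W = ‖ζ₊‖² + ‖ζ₋‖²`,
`X = N|σ(ζ₊,Ψ) + σ(Ψ,ζ₋)|`, `C_k = CL²/‖n‖²`: (W2) turns the dual-norm bound into
`X² ≤ A_n(1 + W) + η`, `A_n = 2C(4π²c₁ + c₂ρaL²/‖n‖²)` (cancel the finite `2C_kE₀W` on both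
sides — this is where `E₀ ≠ ⊤` is used), (W3) gives `W ≤ 2X + d`, hence
`((W − d)₊)² ≤ 4A_n(1 + W) + 4η` and `W ≤ 6A_n + 2 + 2√η + 3d`, and (W4) `n_k ≤ 2W + d`; sum over
the window with the lattice counts
`#{0 < ‖n‖_∞ ≤ J} ≤ (2J+1)³ − 1 ≤ 26J³` (`J = M√ρL/2π ≥ 1` when the window is non-empty) and
`Σ_{0<‖n‖_∞≤J} ‖n‖_∞^{-2} ≤ 26J` (shells of size `24j²+2`; cf. the disprover's `sum_inv_supNorm_le`),
plus the defect budget `Σ_window d ≤ γ√ρN`; take `ρ₁ = min`, `N₁ = max`, `δ = min(δ_A(R), δ_B)`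
with `R` the a-priori radius of the family and `η = 1`. Output `K = K(C, c₁, c₂, γ, M, a)`. Why it
might fail: bookkeeping only (the two lattice counts are not in Mathlib). [KennedyLiebShastry1988;
KLS1988JSP; LSSY2005 Ch. 5 (mode counting)] -/
def Sig.stub_windowLaw : Prop :=
  TwoSidedDualNorm → DressedWitnessFamily → WindowBound

/-- **Signature of `stub_modeCounting` — PARSEVAL + KINETIC CHEBYSHEV + DYSON (size M; provable now
from tree facts; triage r1 F3: "file ModeCounting as the first, provable-now stub").**
`WindowBound → Consequent`. For admissible `v` (range `R₀`, `a ≤ R₀` by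
`LSSY2005_scatteringLength_le_range_holds`): Dyson's bound `LSSY2005_upperBound_periodic_holds`
gives `C_D, c_D` with `E₀^per(N,L) ≤ 4πρ₁a(1 + C_D a/b)N < ∞` for `N ≥ 2`, `2R₀ < L`, `a/b ≤ c_D`
(this discharges the hypothesis `E₀ ≠ ⊤` of `WindowBound` along `L_N = (N/ρ)^{1/3}`,
`div_sideLength_pow_three`); choose `M` with `M² ≥ 32πa(1 + C_D c_D) + 1`, take `WindowBound` at
`(v, M)` (constants `ρ₁, K, N₁`), `ρ₀ = min(ρ₁, 1/(64K²), Dyson's density threshold, 1/(8R₀)³)`,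
`c = 1/2`; for `ρ < ρ₀` and all large `N` put `δ = min(δ_W, M²ρN/8)`: then by
`PeriodicTrialState.tsum_cellOccupation_planeWaveMode` (`Σ_p n_p = N`),
`tsum_fracDispersion_two_mul_cellOccupation` (`Σ_p |2πp/L|²n_p = T(Ψ) ≤ E(Ψ)`) and the split
`ℤ³ = {0} ∪ window ∪ tail` (`|2πp/L|₂ ≥ 2π‖p‖_∞/L > M√ρ` on the tail):
`n₀ ≥ N − K√ρN − (E₀+δ)/(M²ρ) ≥ N − N/8 − N/8 − N/8 ≥ N/2`. Why it might fail: it cannot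
(all inputs proved); `ℝ≥0∞` bookkeeping. [LSSY2005 Thm 2.2, §1.2 (1.17)–(1.18), Ch. 5; Fournais2020 (1.3)–(1.5)] -/
def Sig.stub_modeCounting : Prop :=
  WindowBound → Consequent

/-! ## §4 The registered stubs (`sorry` lives only in these four theorems) -/

/-- Registered stub 1 — variational KLS step (GD ⇒ two-sided dual-norm bound at near-minimisers). -/
theorem stub_chordVariation : Sig.stub_chordVariation := by
  sorry

/-- Registered stub 2 — the Dyson-dressed core-safe witness family (HARDEST, load-bearing). -/
theorem stub_dressedWitness : Sig.stub_dressedWitness := by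
  sorry

/-- Registered stub 3 — per-mode solve + window lattice count. -/
theorem stub_windowLaw : Sig.stub_windowLaw := by
  sorry

/-- Registered stub 4 — Parseval + kinetic Chebyshev + Dyson (provable now). -/
theorem stub_modeCounting : Sig.stub_modeCounting := by
  sorry

/-! ## §5 Composition (sorry-free): the four stubs give the crux BY NAME -/

/-- **The line concludes the crux BY NAME**: GD ⟶ (stub 1) two-sided dual-norm bound ⟶ (stub 3, fed
with the dressed witnesses of stub 2) window bound ⟶ (stub 4) condensation of the near-minimisers. -/
theorem GDTransfer_of :
    Sig.stub_chordVariation → Sig.stub_dressedWitness → Sig.stub_windowLaw →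
      Sig.stub_modeCounting → GDTransfer := by
  intro hCV hDW hWL hMC
  exact gdTransfer_iff.mpr fun hGD => hMC (hWL (hCV hGD) hDW)

/-- Wiring check: the crux modulo the four registered stubs (an `example`, so that `GDTransfer_of`
is the only theorem of the file concluding the crux). -/
example : GDTransfer :=
  GDTransfer_of stub_chordVariation stub_dressedWitness stub_windowLaw stub_modeCounting

/-! ## §6 Sanity lemmas pinning the vocabulary (sorry-free) -/

/-- The tree facts the provable-now stub rests on are in scope: Dyson's upper bound and `a ≤ R₀`. -/
example : LSSY2005_upperBound_periodic ∧ LSSY2005_scatteringLength_le_range :=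
  ⟨LSSY2005_upperBound_periodic_holds, LSSY2005_scatteringLength_le_range_holds⟩

/-- Parseval in the traced variable, as used by `stub_modeCounting`: the occupations of this file
sum to `N`. -/
example {L : ℝ} (hL : 0 < L) (Ψ : PeriodicTrialState (m + 1) L) :
    ∑' p : Fin 3 → ℤ, occ L p Ψ.ψ = (m + 1 : ℕ) :=
  Ψ.tsum_cellOccupation_planeWaveMode hL

/-- Kinetic Chebyshev input, as used by `stub_modeCounting`: `Σ_p |2πp/L|² n_p ≤ E(Ψ)`. -/
example {L : ℝ} (hL : 0 < L) (v : ℝ → ℝ≥0∞) (Ψ : PeriodicTrialState (m + 1) L) :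
    ∑' p : Fin 3 → ℤ, fracDispersion 2 L p * occ L p Ψ.ψ ≤ periodicEnergy v Ψ := by
  unfold occ
  rw [tsum_fracDispersion_two_mul_cellOccupation hL Ψ]
  exact lintegral_mono fun X => le_self_add

/-- A window sum of occupations never exceeds `N` (so `WindowBound` has content only through the
factor `K√ρ < 1`). -/
theorem windowSum_occ_le {L : ℝ} (hL : 0 < L) (M : ℝ) (Ψ : PeriodicTrialState (m + 1) L) :
    windowSum M m L (fun p => occ L p Ψ.ψ) ≤ (m + 1 : ℕ) := by
  rw [← Ψ.tsum_cellOccupation_planeWaveMode hL]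
  exact ENNReal.tsum_le_tsum fun p => Set.indicator_le_self _ _ p


/-! ## §7 Toolkit for the provers (sorry-free): directions form a module, have finite mass, obey the
variational principle `E₀‖ζ‖² ≤ 𝓔(ζ)` (so the excess form `q̃ = 𝓔 − E₀‖·‖²` of the line is
NON-NEGATIVE — the fact behind (W2) and behind the Cauchy–Schwarz / parallelogram steps of
`stub_chordVariation` and `stub_windowLaw`), and `𝓔`, `‖·‖²` scale quadratically. The parallelogram
laws `𝓔(ζ+ξ) + 𝓔(ζ−ξ) = 2𝓔(ζ) + 2𝓔(ξ)`, `‖ζ+ξ‖² + ‖ζ−ξ‖² = 2‖ζ‖² + 2‖ξ‖²` are the tree's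
`lintegral_periodicEnergy_add_add_sub`, `lintegral_cellN_sq_add_add_sub`
(`PeriodicClusteringFromKyFanGap.lean`, landed 2026-08-16; not imported here only because the farm had
not built it yet when this skeleton was checked). -/

section Toolkit

variable {L : ℝ}

theorem IsDirection.add {ζ ξ : Config (m + 1) → ℂ} (hζ : IsDirection m L ζ) (hξ : IsDirection m L ξ) :
    IsDirection m L (ζ + ξ) :=
  ⟨hζ.contDiff.add hξ.contDiff, fun X i k => by simp only [Pi.add_apply, hζ.periodic, hξ.periodic],
    fun σ X => by simp only [Pi.add_apply, hζ.symm, hξ.symm]⟩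

theorem IsDirection.sub {ζ ξ : Config (m + 1) → ℂ} (hζ : IsDirection m L ζ) (hξ : IsDirection m L ξ) :
    IsDirection m L (ζ - ξ) :=
  ⟨hζ.contDiff.sub hξ.contDiff, fun X i k => by simp only [Pi.sub_apply, hζ.periodic, hξ.periodic],
    fun σ X => by simp only [Pi.sub_apply, hζ.symm, hξ.symm]⟩

theorem IsDirection.const_mul {ζ : Config (m + 1) → ℂ} (hζ : IsDirection m L ζ) (c : ℂ) :
    IsDirection m L (fun X => c * ζ X) :=
  ⟨contDiff_const.mul hζ.contDiff, fun X i k => by simp only [hζ.periodic],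
    fun σ X => by simp only [hζ.symm]⟩

/-- A continuous function (in particular a direction) has finite mass on the cell. -/
theorem mass_ne_top {ζ : Config (m + 1) → ℂ} (hζ : Continuous ζ) : mass L ζ ≠ ⊤ := by
  have h := (integrableOn_cellN ((hζ.norm).pow 2) L).hasFiniteIntegral
  rw [HasFiniteIntegral] at h
  refine ne_of_lt (lt_of_le_of_lt (le_of_eq (lintegral_congr fun X => ?_)) h)
  rw [coe_nnnorm_sq_eq_ofReal, Pi.pow_apply, Real.enorm_eq_ofReal (sq_nonneg _)]

/-- `|∇(cζ)|² = |c|²|∇ζ|²` pointwise. -/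
theorem kineticDensity_const_mul' (c : ℂ) {ζ : Config (m + 1) → ℂ} (hζ : Differentiable ℝ ζ)
    (X : Config (m + 1)) :
    kineticDensity (fun Y => c * ζ Y) X = (‖c‖₊ : ℝ≥0∞) ^ 2 * kineticDensity ζ X := by
  unfold kineticDensity
  have h : fderiv ℝ (fun Y => c * ζ Y) X = c • fderiv ℝ ζ X := fderiv_fun_const_smul (hζ X) c
  rw [h]
  simp only [FunLike.coe_smul, Pi.smul_apply, smul_eq_mul, Finset.mul_sum]
  refine Finset.sum_congr rfl fun i _ => Finset.sum_congr rfl fun k _ => ?_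
  rw [nnnorm_mul, ENNReal.coe_mul, mul_pow]

/-- Scaling of the mass: `‖cζ‖² = |c|²‖ζ‖²`. -/
theorem mass_const_mul (c : ℂ) (ζ : Config (m + 1) → ℂ) :
    mass L (fun X => c * ζ X) = (‖c‖₊ : ℝ≥0∞) ^ 2 * mass L ζ := by
  unfold mass
  rw [← lintegral_const_mul' _ _ (ENNReal.pow_ne_top ENNReal.coe_ne_top)]
  refine lintegral_congr fun X => ?_
  rw [nnnorm_mul, ENNReal.coe_mul, mul_pow]

/-- Scaling of the energy form: `𝓔(cζ) = |c|²𝓔(ζ)`. -/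
theorem eform_const_mul (v : ℝ → ℝ≥0∞) (c : ℂ) {ζ : Config (m + 1) → ℂ} (hζ : ContDiff ℝ 1 ζ) :
    eform v L (fun X => c * ζ X) = (‖c‖₊ : ℝ≥0∞) ^ 2 * eform v L ζ := by
  unfold eform
  rw [← lintegral_const_mul' _ _ (ENNReal.pow_ne_top ENNReal.coe_ne_top)]
  refine lintegral_congr fun X => ?_
  rw [kineticDensity_const_mul' c (hζ.differentiable one_ne_zero) X, nnnorm_mul, ENNReal.coe_mul,
    mul_pow]
  ring

/-- **Variational principle for directions** (`q̃ ≥ 0`): `E₀ · ‖ζ‖² ≤ 𝓔(ζ)` for every direction `ζ`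
(normalise `ζ` with `PeriodicTrialState.ofFun` when `‖ζ‖² ≠ 0`; trivial when it vanishes). -/
theorem IsDirection.groundStateEnergy_mul_mass_le (v : ℝ → ℝ≥0∞) {ζ : Config (m + 1) → ℂ}
    (hζ : IsDirection m L ζ) :
    periodicGroundStateEnergy v (m + 1) L * mass L ζ ≤ eform v L ζ := by
  by_cases h0 : mass L ζ = 0
  · simp [h0]
  have htop : mass L ζ ≠ ⊤ := mass_ne_top hζ.contDiff.continuous
  set Ψ : PeriodicTrialState (m + 1) L :=
    PeriodicTrialState.ofFun ζ hζ.contDiff hζ.periodic hζ.symm h0 htop with hΨdef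
  set a : ℂ := ((Real.sqrt (mass L ζ).toReal)⁻¹ : ℂ) with ha_def
  have hΨ : Ψ.ψ = fun X => a * ζ X := rfl
  have hIpos : 0 < (mass L ζ).toReal := ENNReal.toReal_pos h0 htop
  have ha : (‖a‖₊ : ℝ≥0∞) ^ 2 = (mass L ζ)⁻¹ := by
    rw [coe_nnnorm_sq_eq_ofReal, ha_def, norm_inv, Complex.norm_real,
      Real.norm_of_nonneg (Real.sqrt_nonneg _), inv_pow, Real.sq_sqrt hIpos.le,
      ENNReal.ofReal_inv_of_pos hIpos, ENNReal.ofReal_toReal htop]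
  have h1 : periodicGroundStateEnergy v (m + 1) L ≤ (mass L ζ)⁻¹ * eform v L ζ := by
    calc periodicGroundStateEnergy v (m + 1) L ≤ periodicEnergy v Ψ := periodicGroundStateEnergy_le v Ψ
      _ = eform v L Ψ.ψ := (eform_trialState v Ψ).symm
      _ = (‖a‖₊ : ℝ≥0∞) ^ 2 * eform v L ζ := by rw [hΨ]; exact eform_const_mul v a hζ.contDiff
      _ = (mass L ζ)⁻¹ * eform v L ζ := by rw [ha]
  calc periodicGroundStateEnergy v (m + 1) L * mass L ζ
      ≤ (mass L ζ)⁻¹ * eform v L ζ * mass L ζ := by gcongr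
    _ = eform v L ζ := by
        rw [mul_comm ((mass L ζ)⁻¹) _, mul_assoc, ENNReal.inv_mul_cancel h0 htop, mul_one]

/-- Hence for a direction the excess `𝓔(ζ) − E₀‖ζ‖²` is a genuine element of `[0, ∞]`:
`𝓔(ζ) = E₀‖ζ‖² + (𝓔(ζ) − E₀‖ζ‖²)` (truncated subtraction is exact). -/
theorem IsDirection.eform_eq_add_tsub (v : ℝ → ℝ≥0∞) {ζ : Config (m + 1) → ℂ} (hζ : IsDirection m L ζ) :
    eform v L ζ = periodicGroundStateEnergy v (m + 1) L * mass L ζ +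
      (eform v L ζ - periodicGroundStateEnergy v (m + 1) L * mass L ζ) :=
  (add_tsub_cancel_of_le (hζ.groundStateEnergy_mul_mass_le v)).symm

end Toolkit

end Summit.AtomisticToContinuum.BoseEinsteinCondensation.Cruxes.GDTransfer.DysonDressedWitness

end
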